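import Literature.Analysis.FluidPDE.ElgindiHkCoercivity
import Literature.Analysis.FluidPDE.ElgindiHkTools
import HarnessLib

/-!
# The `𝓗ᵏ` norm of the tree against the block quantities, and Proposition 6.13 in `𝓗ᵏ`-norm form
([Elgindi2021] Proposition 6.13 / [ElgindiGhoulMasmoudi2021] Proposition 3.2)

Topic `Literature/Analysis/FluidPDE`. Proof file (everything proved, no definitions, no named
facts) on the proof path of the named fact
`Literature.Analysis.FluidPDE.Elgindi.ElgindiGhoulMasmoudi2021_stabilityCore`
(`ElgindiStabilityDecomposition.lean`). T. M. Elgindi, Ann. of Math. 194 (2021) =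
arXiv:1904.04795, §6.3 Proposition 6.13 ("`(𝓛_Γ^T(f), f)_{𝓗ᵏ} ≥ c_k|f|²_{𝓗ᵏ}`") and
Elgindi–Ghoul–Masmoudi 2021, arXiv:1910.14071, §3.1 Proposition 3.2.

The squared `𝓗ᵏ` norm of the tree (`eHkNormSq`, `ElgindiWeightedSpaces.lean`:
`Σ_{j≤k}‖D_z^jf·w/sin^{η/2}‖² + Σ_{i≥1,i+j≤k}‖D_θ^iD_z^jf·w·sin^{−γ/2}‖²`, `[0,∞]`-valued) is, for a
test function, controlled by the block quantities of the words of order `≤ k − 1`: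
every radial term is `ofReal (sqW_η(D_z^jf))` and every mixed term is `ofReal (sqW_γ(D_θ^iD_z^jf))`
(`eL2Sq_hkRadialTerm_eq`, `eL2Sq_hkMixedTerm_eq`), each of which is one component of one `bQ`, so
`|f|²_{𝓗ᵏ} ≤ ((k+1) + (k+1)²)·ofReal (Σ_{i+j≤k−1} bQ(D_θ^iD_z^jf))` (`eHkNormSq_le_sum_bQ`). With
`hkCoercivity` this gives the printed shape: `c_k·|f|²_{𝓗ᵏ} ≤ (𝓛_Γ^Tf, f)_{𝓗ᵏ}` for all smooth test
functions with `L₁₂(f)(0) = 0` and `0 < α ≤ 10⁻¹⁴` (`hkCoercivity_eHkNormSq`).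
-/

noncomputable section

open MeasureTheory Set Function Real Filter Finset
open scoped ENNReal
open _root_.Topology

namespace Literature.Analysis.FluidPDE

namespace Elgindi

/-! ### The weights of the tree, squared -/

/-- `(x·w/sin^{η/2})² = (xw)²·sin^{−η}` on the open strip. [folklore] -/
theorem sq_mul_hWeight {p : ℝ × ℝ} (hp : p ∈ strip) (x : ℝ) :
    (x * hWeight p.1 p.2) ^ 2 = (x * radialWeight p.1) ^ 2 * wEta p.2 := by
  have hs : 0 < Real.sin (2 * p.2) := Real.sin_pos_of_pos_of_lt_pi (by linarith [hp.2.1]) (by linarith [hp.2.2])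
  have h2 : (Real.sin (2 * p.2) ^ (eta / 2)) ^ 2 = Real.sin (2 * p.2) ^ eta := by
    rw [sq, ← Real.rpow_add hs]; ring_nf
  have hpos : 0 < Real.sin (2 * p.2) ^ (eta / 2) := Real.rpow_pos_of_pos hs _
  unfold hWeight wEta
  rw [Real.rpow_neg hs.le, mul_div_assoc', div_pow, h2]
  field_simp

/-- `(x·w·sin^{−γ/2})² = (xw)²·sin^{−γ}` on the open strip. [folklore] -/
theorem sq_mul_totalWeight (α : ℝ) {p : ℝ × ℝ} (hp : p ∈ strip) (x : ℝ) :
    (x * totalWeight α p.1 p.2) ^ 2 = (x * radialWeight p.1) ^ 2 * wGam α p.2 := by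
  have hs : 0 < Real.sin (2 * p.2) := Real.sin_pos_of_pos_of_lt_pi (by linarith [hp.2.1]) (by linarith [hp.2.2])
  have h2 : (Real.sin (2 * p.2) ^ (-(gammaExp α / 2))) ^ 2 = Real.sin (2 * p.2) ^ (-gammaExp α) := by
    rw [sq, ← Real.rpow_add hs]; ring_nf
  unfold totalWeight thetaWeight wGam
  rw [← h2]
  ring

/-! ### The terms of `eHkNormSq` of a test function -/

/-- **Radial terms**: `eL2Sq (hkRadialTerm j f) = ofReal (sqW_η(D_z^jf))` for `D_z^jf` continuous
and compactly supported inside the open strip. [folklore] -/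
theorem eL2Sq_hkRadialTerm_eq {f : ℝ → ℝ → ℝ} {j : ℕ} (hc : Continuous (uncurry (Dz^[j] f)))
    (hs : HasCompactSupport (uncurry (Dz^[j] f))) (hsub : tsupport (uncurry (Dz^[j] f)) ⊆ strip) :
    eL2Sq (hkRadialTerm j f) = ENNReal.ofReal (sqW wEta (Dz^[j] f)) := by
  rw [eL2Sq_eq_lintegral_ofReal, sqW_def]
  have e : ∀ p ∈ strip, ENNReal.ofReal ((hkRadialTerm j f p.1 p.2) ^ 2) =
      ENNReal.ofReal ((Dz^[j] f p.1 p.2 * radialWeight p.1) ^ 2 * wEta p.2) := by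
    intro p hp
    rw [hkRadialTerm, sq_mul_hWeight hp]
  rw [setLIntegral_congr_fun measurableSet_strip e,
    ← ofReal_integral_eq_lintegral_ofReal (integrableOn_sqW isWeight_wEta hc hs hsub)]
  rw [EventuallyLE, ae_restrict_iff' measurableSet_strip]
  exact Filter.Eventually.of_forall fun p hp => mul_nonneg (sq_nonneg _) (isWeight_wEta.nonneg p.2 hp.2)

/-- **Mixed terms**: `eL2Sq (hkMixedTerm α i j f) = ofReal (sqW_γ(D_θ^iD_z^jf))`. [folklore] -/
theorem eL2Sq_hkMixedTerm_eq (α : ℝ) {f : ℝ → ℝ → ℝ} {i j : ℕ} (hc : Continuous (uncurry (Dθ^[i] (Dz^[j] f))))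
    (hs : HasCompactSupport (uncurry (Dθ^[i] (Dz^[j] f)))) (hsub : tsupport (uncurry (Dθ^[i] (Dz^[j] f))) ⊆ strip) :
    eL2Sq (hkMixedTerm α i j f) = ENNReal.ofReal (sqW (wGam α) (Dθ^[i] (Dz^[j] f))) := by
  rw [eL2Sq_eq_lintegral_ofReal, sqW_def]
  have e : ∀ p ∈ strip, ENNReal.ofReal ((hkMixedTerm α i j f p.1 p.2) ^ 2) =
      ENNReal.ofReal ((Dθ^[i] (Dz^[j] f) p.1 p.2 * radialWeight p.1) ^ 2 * wGam α p.2) := by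
    intro p hp
    rw [hkMixedTerm, sq_mul_totalWeight α hp]
  rw [setLIntegral_congr_fun measurableSet_strip e,
    ← ofReal_integral_eq_lintegral_ofReal (integrableOn_sqW (isWeight_wGam α) hc hs hsub)]
  rw [EventuallyLE, ae_restrict_iff' measurableSet_strip]
  exact Filter.Eventually.of_forall fun p hp => mul_nonneg (sq_nonneg _) ((isWeight_wGam α).nonneg p.2 hp.2)

/-! ### `|f|²_{𝓗ᵏ}` against the block quantities of the words of order `≤ k − 1` -/

/-- **`|f|²_{𝓗ᵏ} ≤ ((k+1)+(k+1)²)·ofReal (Σ_{i+j≤k−1} bQ(D_θ^iD_z^jf))`** for a smooth test function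
`f` and `k ≥ 1`. [cite: Elgindi2021, §1.7.2 and §6.3 (the 𝓗ᵏ norm vs. the inner product (·,·)_{𝓗ᵏ}) (pp. 7, 18 of arXiv:1904.04795)] -/
theorem eHkNormSq_le_sum_bQ (α : ℝ) {k : ℕ} (hk : 1 ≤ k) {f : ℝ → ℝ → ℝ} (hf : ∀ n : ℕ, ContDiff ℝ n (uncurry f))
    (hs : HasCompactSupport (uncurry f)) (hsub : tsupport (uncurry f) ⊆ strip) :
    eHkNormSq α k f ≤ (((k + 1) + (k + 1) ^ 2 : ℕ) : ℝ≥0∞) *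
      ENNReal.ofReal (∑ w ∈ WSet (k - 1) (k - 1), bQ α (word w.1 w.2 f)) := by
  have hsum0 : ∀ w ∈ WSet (k - 1) (k - 1), 0 ≤ bQ α (word w.1 w.2 f) := fun w _ => bQ_nonneg α _
  refine eHkNormSq_le_of_forall_le (fun j hj => ?_) (fun i j hi hij => ?_)
  · -- radial term `j`: `sqW_η(D_z^j f)` is the `X`-component of the word `(0,j)` (`j ≤ k-1`) or the
    -- `Z`-component of the word `(0,k-1)` (`j = k`)
    obtain ⟨hc, hcs, hcsub⟩ := word_test hf hs hsub 0 j 0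
    have hc' : Continuous (uncurry (Dz^[j] f)) := hc.continuous
    have hcs' : HasCompactSupport (uncurry (Dz^[j] f)) := hcs
    have hcsub' : tsupport (uncurry (Dz^[j] f)) ⊆ strip := hcsub
    rw [eL2Sq_hkRadialTerm_eq hc' hcs' hcsub']
    refine ENNReal.ofReal_le_ofReal ?_
    rcases Nat.lt_or_ge j k with hjk | hjk
    · have hw : ((0, j) : ℕ × ℕ) ∈ WSet (k - 1) (k - 1) := by
        rw [mem_WSet]; simp only; omega
      have h1 : sqW wEta (Dz^[j] f) ≤ bQ α (word 0 j f) := (components_le_bQ α (word 0 j f)).2.1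
      have h2 := Finset.single_le_sum hsum0 hw
      exact h1.trans h2
    · have hjk' : j = k := le_antisymm hj hjk
      subst hjk'
      have hw : ((0, j - 1) : ℕ × ℕ) ∈ WSet (j - 1) (j - 1) := by
        rw [mem_WSet]; simp only; omega
      have e : ∀ p ∈ strip, Dz (word 0 (j - 1) f) p.1 p.2 = Dz^[j] f p.1 p.2 := by
        intro p hp
        rw [Dz_word hf 0 (j - 1) p hp]
        have e' : j - 1 + 1 = j := by omega
        rw [e']
        rfl
      have h1 : sqW wEta (Dz (word 0 (j - 1) f)) ≤ bQ α (word 0 (j - 1) f) := (components_le_bQ α (word 0 (j - 1) f)).1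
      rw [sqW_congr e] at h1
      have h2 := Finset.single_le_sum hsum0 hw
      exact h1.trans h2
  · -- mixed term `(i,j)`, `i ≥ 1`: the `Y`-component of the word `(i-1, j)`
    obtain ⟨hc, hcs, hcsub⟩ := word_test hf hs hsub i j 0
    have hc' : Continuous (uncurry (Dθ^[i] (Dz^[j] f))) := hc.continuous
    have hcs' : HasCompactSupport (uncurry (Dθ^[i] (Dz^[j] f))) := hcs
    have hcsub' : tsupport (uncurry (Dθ^[i] (Dz^[j] f))) ⊆ strip := hcsub
    rw [eL2Sq_hkMixedTerm_eq α hc' hcs' hcsub']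
    refine ENNReal.ofReal_le_ofReal ?_
    have hw : ((i - 1, j) : ℕ × ℕ) ∈ WSet (k - 1) (k - 1) := by
      rw [mem_WSet]; simp only; omega
    have e : Dθ (word (i - 1) j f) = Dθ^[i] (Dz^[j] f) := by
      rw [Dθ_word, word_def]
      have e' : i - 1 + 1 = i := by omega
      rw [e']
    have h1 : sqW (wGam α) (Dθ (word (i - 1) j f)) ≤ bQ α (word (i - 1) j f) := (components_le_bQ α (word (i - 1) j f)).2.2.2
    rw [e] at h1
    have h2 := Finset.single_le_sum hsum0 hw
    exact h1.trans h2

/-- **Proposition 6.13 / Proposition 3.2 in `𝓗ᵏ`-norm form** (vendored, test functions): for every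
`k ≥ 1` there are weights `λ_w > 0`, scales `Λ_w ≥ 1` on the words of order `≤ k − 1` and `c > 0` such
that for all `0 < α ≤ 10⁻¹⁴` and all smooth `f` compactly supported inside the open strip with
`L₁₂(f)(0) = 0`: `ofReal c · |f|²_{𝓗ᵏ} ≤ ofReal ((𝓛_Γ^Tf, f)_{𝓗ᵏ})`, where
`(F, G)_{𝓗ᵏ} = hkForm α (k−1) λ Λ F G = Σ_{i+j≤k−1} λ_{ij}·blockΛ α Λ_{ij} (D_θ^iD_z^jF)(D_θ^iD_z^jG)` is an
inner product of the recursive shape of the printed proofs ("(f,g)_{𝓗ᵏ} = (f,g)_{𝓗^{k−1}} +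
c_{1,k}(D_θf,D_θg)_{𝓗^{k−1}} + c_{2,k}(D_zf,D_zg)_{𝓗^{k−1}}"). [cite: Elgindi2021, §6.3 Proposition 6.13 (p. 18 of arXiv:1904.04795); ElgindiGhoulMasmoudi2021, §3.1 Proposition 3.2 (p. 10 of arXiv:1910.14071)] -/
theorem hkCoercivity_eHkNormSq (k : ℕ) (hk : 1 ≤ k) : ∃ lam Lam : ℕ × ℕ → ℝ, ∃ c : ℝ, 0 < c ∧ (∀ w, 0 < lam w) ∧
    (∀ w, 1 ≤ Lam w) ∧ ∀ α : ℝ, 0 < α → α ≤ 1 / 10 ^ 14 → ∀ f : ℝ → ℝ → ℝ, (∀ n : ℕ, ContDiff ℝ n (uncurry f)) →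
    HasCompactSupport (uncurry f) → tsupport (uncurry f) ⊆ strip → L12 f 0 = 0 →
      ENNReal.ofReal c * eHkNormSq α k f ≤ ENNReal.ofReal (hkForm α (k - 1) lam Lam (opLΓT α f) f) := by
  obtain ⟨lam, Lam, c₀, hc₀, hlam, hLam, h⟩ := hkCoercivity (k - 1)
  set N : ℕ := (k + 1) + (k + 1) ^ 2 with hN
  have hNpos : (0 : ℝ) < N := by positivity
  refine ⟨lam, Lam, c₀ / N, by positivity, hlam, hLam, ?_⟩
  intro α hα hα14 f hf hs hsub hL0
  have h1 := eHkNormSq_le_sum_bQ α hk hf hs hsub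
  have h2 := h α hα hα14 f hf hs hsub hL0
  have hS0 : 0 ≤ ∑ w ∈ WSet (k - 1) (k - 1), bQ α (word w.1 w.2 f) := Finset.sum_nonneg fun w _ => bQ_nonneg α _
  calc ENNReal.ofReal (c₀ / N) * eHkNormSq α k f
      ≤ ENNReal.ofReal (c₀ / N) * ((N : ℝ≥0∞) * ENNReal.ofReal (∑ w ∈ WSet (k - 1) (k - 1), bQ α (word w.1 w.2 f))) :=
        mul_le_mul_right h1 _
    _ = ENNReal.ofReal (c₀ * ∑ w ∈ WSet (k - 1) (k - 1), bQ α (word w.1 w.2 f)) := by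
        rw [← mul_assoc, ← ENNReal.ofReal_natCast, ← ENNReal.ofReal_mul (by positivity),
          ← ENNReal.ofReal_mul (by positivity)]
        congr 1
        field_simp
    _ ≤ ENNReal.ofReal (hkForm α (k - 1) lam Lam (opLΓT α f) f) := ENNReal.ofReal_le_ofReal h2

end Elgindi

end Literature.Analysis.FluidPDE
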